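import Literature.Analysis.PDE.DifferenceQuotientRegularity
import HarnessLib

/-!
# The difference-quotient regularity step `C^{2,α} ⇒ C^{3,α}`
(helper file for stub O3 `stub_regularity`, layer R3gen `helper_dqRegularityStep`, line
`margerin-cone-hamilton-rails`, crux `EntropyRung.ChangGurskyYang`, item stmt-SmoothPoincare4-10834)

For the Gursky–Viaclovsky path equation written in a chart as a fully nonlinear uniformly
elliptic equation `H(c(y), J²v(y)) = 0` with SMOOTH structure `H`, coefficients `c ∈ C^{1,α}`
and a `C^{2,α}` solution `v` on a ball `B(x₀, R)`, uniformly elliptic on rank-one top-slot jets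
near the graph, the solution is `C^{3,α}` on every smaller ball `B(x₀, ρ)`, with bounds
(Gilbarg–Trudinger 2001, Lemma 17.16, regularity half, first step: difference quotients of `v`
solve frozen linear equations with uniformly `C^α` data, the interior Schauder estimate for
`C^{2,α}` functions bounds them in `C^{2,α}` uniformly, and the bounds pass to the limits
`∂_k v`). This file is the specialisation to the stub's quantifier shape of
`Literature.Analysis.PDE.contDiffOn_three_and_bounds_of_holderTwo_solution`
(`Literature/Analysis/PDE/DifferenceQuotientRegularity.lean`).

## References

* D. Gilbarg, N. S. Trudinger, *Elliptic Partial Differential Equations of Second Order*,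
  Springer Classics in Mathematics (2001), Lemma 17.16 and Cor. 6.3. [GilbargTrudinger2001]
-/

noncomputable section

-- every `Summit.SmoothPoincare4.SmoothPoincare4.…` name repeats the summit = sub-problem segment (D-0017 layout)
set_option linter.dupNamespace false

namespace Summit.SmoothPoincare4.SmoothPoincare4.Theorems.MargerinRails

/-- **R3gen: the difference-quotient regularity step `C^{2,α} ⇒ C^{3,α}`** for a fully
nonlinear uniformly elliptic equation `H(c(y), J²v(y)) = 0` with smooth structure `H`,
coefficients `c ∈ C^{1,α}` and a `C^{2,α}` solution `v` on `B(x₀, R)`: for every `0 < ρ < R`,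
`v ∈ C³(B(x₀, ρ))` with bounds `‖Dʲv‖ ≤ B'` (`j ≤ 3`) and `[D³v]_α ≤ B'`
(Gilbarg–Trudinger 2001, Lemma 17.16; the tree's
`Literature.Analysis.PDE.contDiffOn_three_and_bounds_of_holderTwo_solution`).
[cite: GilbargTrudinger2001, Lemma 17.16] -/
theorem helper_dqRegularityStep :
    ∀ {ι : Type} [Fintype ι] [DecidableEq ι] {E : Type} [NormedAddCommGroup E] [InnerProductSpace ℝ E]
      [FiniteDimensional ℝ E] [MeasurableSpace E] [BorelSpace E] [Nontrivial E]
      {P : Type} [NormedAddCommGroup P] [NormedSpace ℝ P] [FiniteDimensional ℝ P]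
      (bE : OrthonormalBasis ι ℝ E) {α : NNReal}, 0 < α → α < 1 →
      ∀ (H : P × Literature.Analysis.Calculus.CJet ι 2 → ℝ),
      ContDiff ℝ ((⊤ : ℕ∞) : WithTop ℕ∞) H →
      ∀ (c : E → P) (v : E → ℝ) (x₀ : E) (R : ℝ), 0 < R →
      ContDiffOn ℝ 1 c (Metric.ball x₀ R) →
      (∃ Bc : NNReal, (∀ y ∈ Metric.ball x₀ R, ∀ j ≤ 1, ‖iteratedFDeriv ℝ j c y‖ ≤ Bc) ∧
        HolderOnWith Bc α (iteratedFDeriv ℝ 1 c) (Metric.ball x₀ R)) →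
      ContDiffOn ℝ 2 v (Metric.ball x₀ R) →
      (∃ Bv : NNReal, (∀ y ∈ Metric.ball x₀ R, ∀ j ≤ 2, ‖iteratedFDeriv ℝ j v y‖ ≤ Bv) ∧
        HolderOnWith Bv α (iteratedFDeriv ℝ 2 v) (Metric.ball x₀ R)) →
      (∀ y ∈ Metric.ball x₀ R, H (c y, Literature.Analysis.Calculus.cjetOf bE 2 v y) = 0) →
      (∃ l δ : ℝ, 0 < l ∧ 0 < δ ∧ ∀ y ∈ Metric.ball x₀ R,
        ∀ (p' : P) (J' : Literature.Analysis.Calculus.CJet ι 2),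
          ‖p' - c y‖ < δ → ‖J' - Literature.Analysis.Calculus.cjetOf bE 2 v y‖ < δ →
          ∀ η : E →L[ℝ] ℝ, l * ‖η‖ ^ 2 ≤
            fderiv ℝ H (p', J') ((0 : P), Pi.single (Fin.last 2)
              (fun I : Fin 2 → ι => η (bE (I 0)) * η (bE (I 1))))) →
      ∀ ρ : ℝ, 0 < ρ → ρ < R →
        ContDiffOn ℝ 3 v (Metric.ball x₀ ρ) ∧
        ∃ B' : NNReal, (∀ y ∈ Metric.ball x₀ ρ, ∀ j ≤ 3, ‖iteratedFDeriv ℝ j v y‖ ≤ B') ∧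
          HolderOnWith B' α (iteratedFDeriv ℝ 3 v) (Metric.ball x₀ ρ) := by
  intro ι _ _ E _ _ _ _ _ _ P _ _ _ bE α hα hα1 H hH c v x₀ R _hR hc hcB hv hvB heq hell ρ hρ hρR
  obtain ⟨Bc, hBc, hHc⟩ := hcB
  obtain ⟨Bv, hBv, hHv⟩ := hvB
  obtain ⟨l, δ, hl, hδ, hell⟩ := hell
  exact Literature.Analysis.PDE.contDiffOn_three_and_bounds_of_holderTwo_solution bE hα hα1 hH
    hc hBc hHc hv hBv hHv heq hl hδ hell hρ hρR

end Summit.SmoothPoincare4.SmoothPoincare4.Theorems.MargerinRails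

end
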